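import Mathlib.Data.Complex.Basic
import Mathlib.Algebra.BigOperators.Fin
import Mathlib.LinearAlgebra.BilinearMap
import Mathlib.Tactic.LinearCombination
import Mathlib.Tactic.FinCases
import Mathlib.Tactic.Module
import Mathlib.Tactic.Abel
import HarnessLib

/-!
# The tensor skeleton `𝔤𝔩₂ ⊗ 1 + 1 ⊗ 𝔤𝔩₃` on `W ≅ ℂ² ⊗ ℂ³`: SEGRE VANISHING — a symmetric bilinear form killed by every
# rank-one «decomposable» compression lies in `∧² ⊗ ∧²` and is annihilated by `𝔰𝔩₂ ⊗ 1`
# (Moonen–Zarhin 1999 (2.5); `Sym²(A ⊗ B) = Sym²A ⊗ Sym²B ⊕ ∧²A ⊗ ∧²B`, Fulton–Harris Ex. 6.11; classification-free)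

Family `hodge`, layer `Literature/AlgebraicGeometry/Motives` (pure linear algebra; no geometry). Written for the cell
`pub-hodgeav-hg6` (req-37 (A) row 2 «base of HC ladder», TABLE X row 1 `g6.I(1)`: the `r = 4` RETURN LEG of the rank-twelve
crux `RankTwelveSimpleCrux34` by SEGRE COMPRESSION, bricks S2–S4 of the lead's plan; eng-2 lineage g5; honest framing of
that cell: HC / HC_AV / HC_CM NOT proved — THIS file is unconditional linear algebra). UNCONDITIONAL; theorems only — no
definition, no named fact (D-0026), no `sorry`.

SETTING (the outputs of the tree's skeleton bricks `UnitaryFourTwo.exists_matrix_units` (V3) and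
`UnitaryFourTwo.exists_block_units` (V3b), abstracted and `Fin`-indexed): a complex vector space `W` with
* `2 × 2` BLOCK UNITS `p a b` (`p a b · p b d = p a d`, `p a b · p c d = 0` for `b ≠ c`, `p 0 0 + p 1 1 = 1`),
* `3 × 3` units `f i · g j` given through «column» operators `f i` and «row» operators `g j` with `g j · f j = E`,
  `E · g j = g j`, `Σ f i · g i = 1` (the orthogonality relations `g j f k = 0`, `j ≠ k`, are NOT needed here),
* the two systems commute (`p a b` commutes with every `f i`, `g j`),
* ONE-DIMENSIONAL MULTIPLICITY: the block `p a₀ a₀ · f i₀ · g i₀` has its values on a line `ℂ m₀`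
  (so `W` is spanned by the six vectors `m a i = p a a₀ · f i · g i₀ · m₀`; in the application `W ≅ ℂ² ⊗ ℂ³`).
A symmetric bilinear form `γ` on `W` models a lowering operator `x ∈ 𝔥⁻ ⊂ Hom(V^{1,0}, V^{0,1})` of a weight-one Hodge
structure through `γ(p, p′) = ψ_ℂ(x p, p′)` (the rank-twelve crux, N12's Levi involution algebra on `W = V^{1,0}`).

WHAT IS PROVED.
* §1 bookkeeping: `SkeletonSegre.block_apply_eq_smul` (every diagonal block `p a a · f i · g i` has values on the line
  `ℂ · m a i`), `SkeletonSegre.exists_sum_eq` (the six `m a i` span `W`), the action of the units on the `m a i`, and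
  **`SkeletonSegre.exists_compression_eq_smul`**: the «decomposable» operators
  `R = (f i g i + c′ · f j g i) · (p a a + c · p b a)` have values on a LINE (they are the rank-one operators whose
  compressions the Hodge side can form from idempotents of the Levi algebra).
* §2 **`SkeletonSegre.form_offDiag_eq_zero`**, **`SkeletonSegre.form_diag_eq`** — SEGRE VANISHING: if `γ` is symmetric
  and `γ(R y, R y′) = 0` for all these `R` (`a ≠ b`, `i ≠ j`, all `c, c′`), then `γ(p a₁ a₂ y, y′) + γ(y, p a₁ a₂ y′) = 0`
  for `a₁ ≠ a₂` and `γ(p 0 0 y, y′) + γ(y, p 0 0 y′) = γ(p 1 1 y, y′) + γ(y, p 1 1 y′)`: the traceless part `𝔰𝔩₂ ⊗ 1` of the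
  block algebra annihilates `γ` (in coordinates, `SkeletonSegre.coord_identities`: `γ(m a i, m b j) = 0` unless `a ≠ b` and
  `i ≠ j`, and then `γ(m a i, m b j) = −γ(m a j, m b i)`, i.e. `γ ∈ ∧²(ℂ²)^* ⊗ ∧²(ℂ³)^*`).
WHY (cell `pub-hodgeav-hg6`, lead 2026-08-28T23:33:34Z, plan (I)): with the compression lemma on the Hodge side
(`LeviCompression.form_compression_eq_zero`: `Z₂Z₁ x Z₁Z₂ ∈ 𝔥⁻` for Levi lifts `Zᵢ` of idempotents, vanishing when its
values lie on a line) this shows that the lift of `p 0 1 ≠ 0` commutes with every lowering operator, which is impossible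
in a simple `𝔥_ℂ` — the `r = 4` case of `RankTwelveSimpleCrux34` dies.

## References
* [MoonenZarhin1999LowDim] B. Moonen, Yu. Zarhin, *Hodge classes on abelian varieties of low dimension*, Math. Ann. 315
  (1999), §2 (2.5) (the configuration `𝔤𝔩₂ ⊗ 1 + 1 ⊗ 𝔤𝔩₃` on `ℂ² ⊗ ℂ³`).
* [FultonHarrisGTM129] W. Fulton, J. Harris, *Representation Theory*, §6.1, Exercise 6.11
  (`Sym²(V ⊗ W) = Sym²V ⊗ Sym²W ⊕ ∧²V ⊗ ∧²W`).
-/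

noncomputable section

open Module

namespace Literature.AlgebraicGeometry.Motives

namespace HodgeStructure

variable {W : Type*} [AddCommGroup W] [Module ℂ W]

namespace SkeletonSegre

variable {p : Fin 2 → Fin 2 → Module.End ℂ W} {f g : Fin 3 → Module.End ℂ W} {E : Module.End ℂ W}
  {a₀ : Fin 2} {i₀ : Fin 3} {m₀ : W} {m : Fin 2 → Fin 3 → W}

/-! ### §1 Bookkeeping: blocks, the spanning family `m a i`, the decomposable operators -/

section Bookkeeping

/-- Units: `f i g j · f j g l = f i g l`. [cite: MoonenZarhin1999LowDim, §2 (2.5)] -/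
theorem unit_mul_unit (hgf : ∀ j, g j * f j = E) (hEg : ∀ j, E * g j = g j) (i j l : Fin 3) :
    f i * g j * (f j * g l) = f i * g l := by
  rw [mul_assoc, ← mul_assoc (g j), hgf, hEg]

/-- The block units commute with the `3 × 3` units. [cite: MoonenZarhin1999LowDim, §2 (2.5)] -/
theorem block_mul_unit (hpf : ∀ a b i, p a b * f i = f i * p a b) (hpg : ∀ a b j, p a b * g j = g j * p a b)
    (a b : Fin 2) (i j : Fin 3) : p a b * (f i * g j) = f i * g j * p a b := by
  rw [← mul_assoc, hpf, mul_assoc, hpg, ← mul_assoc]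

/-- Products of the rank-one `6 × 6` units `p a b · f i g j`. [cite: MoonenZarhin1999LowDim, §2 (2.5)] -/
theorem blockUnit_mul_blockUnit (hpp : ∀ a b d, p a b * p b d = p a d)
    (hgf : ∀ j, g j * f j = E) (hEg : ∀ j, E * g j = g j)
    (hpf : ∀ a b i, p a b * f i = f i * p a b) (hpg : ∀ a b j, p a b * g j = g j * p a b)
    (a b d : Fin 2) (i j l : Fin 3) :
    p a b * (f i * g j) * (p b d * (f j * g l)) = p a d * (f i * g l) := by
  calc p a b * (f i * g j) * (p b d * (f j * g l))
      = p a b * ((f i * g j) * p b d) * (f j * g l) := by simp only [mul_assoc]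
    _ = p a b * (p b d * (f i * g j)) * (f j * g l) := by rw [block_mul_unit hpf hpg]
    _ = (p a b * p b d) * ((f i * g j) * (f j * g l)) := by simp only [mul_assoc]
    _ = p a d * (f i * g l) := by rw [hpp, unit_mul_unit hgf hEg]

/-- **Every diagonal block has its values on the line `ℂ · m a i`.** [cite: MoonenZarhin1999LowDim, §2 (2.5)] -/
theorem block_apply_eq_smul (hpp : ∀ a b d, p a b * p b d = p a d)
    (hgf : ∀ j, g j * f j = E) (hEg : ∀ j, E * g j = g j)
    (hpf : ∀ a b i, p a b * f i = f i * p a b) (hpg : ∀ a b j, p a b * g j = g j * p a b)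
    (hline : ∀ y, ∃ t : ℂ, (p a₀ a₀ * (f i₀ * g i₀)) y = t • m₀)
    (hm : ∀ a i, m a i = (p a a₀ * (f i * g i₀)) m₀) (a : Fin 2) (i : Fin 3) (y : W) :
    ∃ t : ℂ, (p a a * (f i * g i)) y = t • m a i := by
  obtain ⟨t, ht⟩ := hline ((p a₀ a * (f i₀ * g i)) y)
  refine ⟨t, ?_⟩
  rw [← Module.End.mul_apply, blockUnit_mul_blockUnit hpp hgf hEg hpf hpg] at ht
  rw [← blockUnit_mul_blockUnit hpp hgf hEg hpf hpg a a₀ a i i₀ i, Module.End.mul_apply, ht, map_smul, hm]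

/-- **The six vectors `m a i` span `W`:** `y = Σ_{a,i} t a i · m a i`. [cite: MoonenZarhin1999LowDim, §2 (2.5)] -/
theorem exists_sum_eq (hpp : ∀ a b d, p a b * p b d = p a d) (hp1 : p 0 0 + p 1 1 = 1)
    (hgf : ∀ j, g j * f j = E) (hEg : ∀ j, E * g j = g j) (hsum : f 0 * g 0 + f 1 * g 1 + f 2 * g 2 = 1)
    (hpf : ∀ a b i, p a b * f i = f i * p a b) (hpg : ∀ a b j, p a b * g j = g j * p a b)
    (hline : ∀ y, ∃ t : ℂ, (p a₀ a₀ * (f i₀ * g i₀)) y = t • m₀)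
    (hm : ∀ a i, m a i = (p a a₀ * (f i * g i₀)) m₀) (y : W) :
    ∃ t : Fin 2 → Fin 3 → ℂ, y = ∑ a, ∑ i, t a i • m a i := by
  choose t ht using fun a i => block_apply_eq_smul hpp hgf hEg hpf hpg hline hm a i y
  refine ⟨t, ?_⟩
  have hy : y = (p 0 0 + p 1 1) ((f 0 * g 0 + f 1 * g 1 + f 2 * g 2) y) := by
    rw [hp1, hsum, Module.End.one_apply, Module.End.one_apply]
  have key : (p 0 0 + p 1 1) ((f 0 * g 0 + f 1 * g 1 + f 2 * g 2) y) = ∑ a, ∑ i, t a i • m a i := by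
    simp only [Fin.sum_univ_two, Fin.sum_univ_three, ← ht, Module.End.mul_apply, LinearMap.add_apply, map_add]
    abel
  exact hy.trans key

/-- `p c a · m a i = m c i`. [cite: MoonenZarhin1999LowDim, §2 (2.5)] -/
theorem block_apply_gen (hpp : ∀ a b d, p a b * p b d = p a d) (hm : ∀ a i, m a i = (p a a₀ * (f i * g i₀)) m₀)
    (c a : Fin 2) (i : Fin 3) : p c a (m a i) = m c i := by
  rw [hm, hm, ← Module.End.mul_apply, ← mul_assoc, hpp]

/-- `p c d · m a i = 0` for `d ≠ a`. [cite: MoonenZarhin1999LowDim, §2 (2.5)] -/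
theorem block_apply_gen_of_ne (hpp0 : ∀ a b c d, b ≠ c → p a b * p c d = 0)
    (hm : ∀ a i, m a i = (p a a₀ * (f i * g i₀)) m₀) (c : Fin 2) {d a : Fin 2} (hda : d ≠ a) (i : Fin 3) :
    p c d (m a i) = 0 := by
  rw [hm, ← Module.End.mul_apply, ← mul_assoc, hpp0 c d a a₀ hda, zero_mul, LinearMap.zero_apply]

/-- `f j g i · m a i = m a j`. [cite: MoonenZarhin1999LowDim, §2 (2.5)] -/
theorem unit_apply_gen (hgf : ∀ j, g j * f j = E) (hEg : ∀ j, E * g j = g j)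
    (hpf : ∀ a b i, p a b * f i = f i * p a b) (hpg : ∀ a b j, p a b * g j = g j * p a b)
    (hm : ∀ a i, m a i = (p a a₀ * (f i * g i₀)) m₀) (a : Fin 2) (j i : Fin 3) :
    (f j * g i) (m a i) = m a j := by
  rw [hm, hm, ← Module.End.mul_apply, ← mul_assoc, ← block_mul_unit hpf hpg, mul_assoc, unit_mul_unit hgf hEg]

/-- **The decomposable operator on the generator:**
`(f i g i + c′ f j g i)(p a a + c p b a) · m a i = m a i + c′ m a j + c m b i + c c′ m b j`.
[cite: MoonenZarhin1999LowDim, §2 (2.5)] -/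
theorem compression_apply_gen (hpp : ∀ a b d, p a b * p b d = p a d)
    (hgf : ∀ j, g j * f j = E) (hEg : ∀ j, E * g j = g j)
    (hpf : ∀ a b i, p a b * f i = f i * p a b) (hpg : ∀ a b j, p a b * g j = g j * p a b)
    (hm : ∀ a i, m a i = (p a a₀ * (f i * g i₀)) m₀) (a b : Fin 2) (i j : Fin 3) (c c' : ℂ) :
    ((f i * g i + c' • (f j * g i)) * (p a a + c • p b a)) (m a i) =
      m a i + c' • m a j + c • m b i + (c * c') • m b j := by
  have hin : (p a a + c • p b a) (m a i) = m a i + c • m b i := by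
    rw [LinearMap.add_apply, LinearMap.smul_apply, block_apply_gen hpp hm, block_apply_gen hpp hm]
  rw [Module.End.mul_apply, hin, map_add, map_smul, LinearMap.add_apply, LinearMap.add_apply, LinearMap.smul_apply,
    LinearMap.smul_apply, unit_apply_gen hgf hEg hpf hpg hm, unit_apply_gen hgf hEg hpf hpg hm,
    unit_apply_gen hgf hEg hpf hpg hm, unit_apply_gen hgf hEg hpf hpg hm, mul_smul]
  module

/-- **The decomposable operators have their values on a line:** `R y ∈ ℂ · R(m a i)` for
`R = (f i g i + c′ f j g i)(p a a + c p b a)` (they factor through the diagonal block `p a a f i g i`).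
[cite: MoonenZarhin1999LowDim, §2 (2.5)] -/
theorem exists_compression_eq_smul (hpp : ∀ a b d, p a b * p b d = p a d)
    (hgf : ∀ j, g j * f j = E) (hEg : ∀ j, E * g j = g j)
    (hpf : ∀ a b i, p a b * f i = f i * p a b) (hpg : ∀ a b j, p a b * g j = g j * p a b)
    (hline : ∀ y, ∃ t : ℂ, (p a₀ a₀ * (f i₀ * g i₀)) y = t • m₀)
    (hm : ∀ a i, m a i = (p a a₀ * (f i * g i₀)) m₀) (a b : Fin 2) (i j : Fin 3) (c c' : ℂ) (y : W) :
    ∃ t : ℂ, ((f i * g i + c' • (f j * g i)) * (p a a + c • p b a)) y =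
      t • ((f i * g i + c' • (f j * g i)) * (p a a + c • p b a)) (m a i) := by
  obtain ⟨t, ht⟩ := block_apply_eq_smul hpp hgf hEg hpf hpg hline hm a i y
  refine ⟨t, ?_⟩
  set A₁ := f i * g i + c' • (f j * g i) with hA₁
  set A₂ := p a a + c • p b a with hA₂
  have h1 : A₂ * p a a = A₂ := by rw [hA₂, add_mul, smul_mul_assoc, hpp, hpp]
  have h2 : A₁ * (f i * g i) = A₁ := by rw [hA₁, add_mul, smul_mul_assoc, unit_mul_unit hgf hEg, unit_mul_unit hgf hEg]
  have h3 : A₂ * (f i * g i) = f i * g i * A₂ := by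
    rw [hA₂, add_mul, mul_add, smul_mul_assoc, mul_smul_comm, block_mul_unit hpf hpg, block_mul_unit hpf hpg]
  -- `R = R · (p a a f i g i)`
  have hR : A₁ * A₂ * (p a a * (f i * g i)) = A₁ * A₂ := by
    calc A₁ * A₂ * (p a a * (f i * g i)) = A₁ * (A₂ * p a a) * (f i * g i) := by simp only [mul_assoc]
      _ = A₁ * (A₂ * (f i * g i)) := by rw [h1, mul_assoc]
      _ = A₁ * (f i * g i) * A₂ := by rw [h3, ← mul_assoc]
      _ = A₁ * A₂ := by rw [h2]
  conv_lhs => rw [← hR, Module.End.mul_apply, ht, map_smul]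

end Bookkeeping

/-! ### §2 Segre vanishing -/

section Segre

variable {γ : W →ₗ[ℂ] W →ₗ[ℂ] ℂ}

/-- **The four coordinate identities behind Segre vanishing:** with `B(a i, b j) = γ(m a i, m b j)`,
`B(a i, a i) = 0`, `B(a i, b i) = 0` (`a ≠ b`), `B(a i, a j) = 0` (`i ≠ j`), `B(a i, b j) + B(a j, b i) = 0`
(`a ≠ b`, `i ≠ j`) — i.e. `γ ∈ ∧² ⊗ ∧²` (polarise the vanishing `γ(r, r) = 0` on the decomposable vectors
`r = m a i + c′ m a j + c m b i + c c′ m b j` in `c, c′ ∈ {0, 1}`). [cite: FultonHarrisGTM129, §6.1 Exercise 6.11]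
[cite: MoonenZarhin1999LowDim, §2 (2.5)] -/
theorem coord_identities (hpp : ∀ a b d, p a b * p b d = p a d)
    (hgf : ∀ j, g j * f j = E) (hEg : ∀ j, E * g j = g j)
    (hpf : ∀ a b i, p a b * f i = f i * p a b) (hpg : ∀ a b j, p a b * g j = g j * p a b)
    (hm : ∀ a i, m a i = (p a a₀ * (f i * g i₀)) m₀) (hγ : ∀ y y', γ y y' = γ y' y)
    (hvan : ∀ (a b : Fin 2) (i j : Fin 3) (c c' : ℂ), a ≠ b → i ≠ j →
      ∀ y y', γ (((f i * g i + c' • (f j * g i)) * (p a a + c • p b a)) y)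
        (((f i * g i + c' • (f j * g i)) * (p a a + c • p b a)) y') = 0) :
    (∀ a i, γ (m a i) (m a i) = 0) ∧ (∀ a b i, a ≠ b → γ (m a i) (m b i) = 0) ∧
      (∀ a i j, i ≠ j → γ (m a i) (m a j) = 0) ∧
      (∀ a b i j, a ≠ b → i ≠ j → γ (m a i) (m b j) + γ (m a j) (m b i) = 0) := by
  have key : ∀ (a b : Fin 2) (i j : Fin 3) (c c' : ℂ), a ≠ b → i ≠ j →
      γ (m a i + c' • m a j + c • m b i + (c * c') • m b j) (m a i + c' • m a j + c • m b i + (c * c') • m b j) = 0 := by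
    intro a b i j c c' hab hij
    have h := hvan a b i j c c' hab hij (m a i) (m a i)
    rwa [compression_apply_gen hpp hgf hEg hpf hpg hm] at h
  -- F1
  have F1 : ∀ a i, γ (m a i) (m a i) = 0 := by
    intro a i
    obtain ⟨b, hb⟩ := exists_ne a
    obtain ⟨j, hj⟩ := exists_ne i
    have h := key a b i j 0 0 hb.symm hj.symm
    simpa using h
  -- F2
  have F2 : ∀ a b i, a ≠ b → γ (m a i) (m b i) = 0 := by
    intro a b i hab
    obtain ⟨j, hj⟩ := exists_ne i
    have h := key a b i j 1 0 hab hj.symm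
    simp only [zero_smul, add_zero, one_smul, mul_zero, map_add, LinearMap.add_apply, F1, zero_add,
      hγ (m b i) (m a i)] at h
    linear_combination (1 / 2 : ℂ) * h
  -- F3
  have F3 : ∀ a i j, i ≠ j → γ (m a i) (m a j) = 0 := by
    intro a i j hij
    obtain ⟨b, hb⟩ := exists_ne a
    have h := key a b i j 0 1 hb.symm hij
    simp only [zero_smul, add_zero, one_smul, zero_mul, map_add, LinearMap.add_apply, F1, zero_add,
      hγ (m a j) (m a i)] at h
    linear_combination (1 / 2 : ℂ) * h
  refine ⟨F1, F2, F3, fun a b i j hab hij => ?_⟩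
  have h := key a b i j 1 1 hab hij
  simp only [one_smul, mul_one, map_add, LinearMap.add_apply, F1, F2 a b i hab, F2 a b j hab, F3 a i j hij,
    F3 b i j hij, hγ (m b i) (m a i), hγ (m b j) (m a j), hγ (m a j) (m a i), hγ (m b j) (m b i), add_zero,
    zero_add] at h
  have hs1 := hγ (m b j) (m a i)
  have hs2 := hγ (m b i) (m a j)
  linear_combination (1 / 2 : ℂ) * h - (1 / 2 : ℂ) * hs1 - (1 / 2 : ℂ) * hs2

/-- A bilinear form vanishing on the pairs of generators `m a i` vanishes (the `m a i` span `W`). [folklore] -/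
private theorem form_eq_zero_of_gen {Φ : W →ₗ[ℂ] W →ₗ[ℂ] ℂ}
    (hspan : ∀ y : W, ∃ t : Fin 2 → Fin 3 → ℂ, y = ∑ a, ∑ i, t a i • m a i)
    (hΦ : ∀ a i b j, Φ (m a i) (m b j) = 0) (y y' : W) : Φ y y' = 0 := by
  obtain ⟨t, rfl⟩ := hspan y
  obtain ⟨t', rfl⟩ := hspan y'
  simp only [map_sum, map_smul, LinearMap.sum_apply, LinearMap.smul_apply, hΦ, smul_zero, Finset.sum_const_zero]

/-- **SEGRE VANISHING, off-diagonal block units:** under the vanishing of all decomposable compressions,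
`γ(p a₁ a₂ y, y′) + γ(y, p a₁ a₂ y′) = 0` for `a₁ ≠ a₂` (the nilpotent part of `𝔰𝔩₂ ⊗ 1` annihilates `γ`).
[cite: FultonHarrisGTM129, §6.1 Exercise 6.11] [cite: MoonenZarhin1999LowDim, §2 (2.5)] -/
theorem form_offDiag_eq_zero (hpp : ∀ a b d, p a b * p b d = p a d) (hpp0 : ∀ a b c d, b ≠ c → p a b * p c d = 0)
    (hp1 : p 0 0 + p 1 1 = 1)
    (hgf : ∀ j, g j * f j = E) (hEg : ∀ j, E * g j = g j) (hsum : f 0 * g 0 + f 1 * g 1 + f 2 * g 2 = 1)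
    (hpf : ∀ a b i, p a b * f i = f i * p a b) (hpg : ∀ a b j, p a b * g j = g j * p a b)
    (hline : ∀ y, ∃ t : ℂ, (p a₀ a₀ * (f i₀ * g i₀)) y = t • m₀)
    (hm : ∀ a i, m a i = (p a a₀ * (f i * g i₀)) m₀) (hγ : ∀ y y', γ y y' = γ y' y)
    (hvan : ∀ (a b : Fin 2) (i j : Fin 3) (c c' : ℂ), a ≠ b → i ≠ j →
      ∀ y y', γ (((f i * g i + c' • (f j * g i)) * (p a a + c • p b a)) y)
        (((f i * g i + c' • (f j * g i)) * (p a a + c • p b a)) y') = 0)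
    {a₁ a₂ : Fin 2} (ha : a₁ ≠ a₂) (y y' : W) : γ (p a₁ a₂ y) y' + γ y (p a₁ a₂ y') = 0 := by
  obtain ⟨F1, F2, F3, F4⟩ := coord_identities hpp hgf hEg hpf hpg hm hγ hvan
  have hspan := exists_sum_eq hpp hp1 hgf hEg hsum hpf hpg hline hm
  have hsame : ∀ a i j, γ (m a i) (m a j) = 0 := fun a i j => by
    by_cases hij : i = j
    · subst hij; exact F1 a i
    · exact F3 a i j hij
  -- the bilinear form `Φ(y, y′) = γ(p a₁ a₂ y, y′) + γ(y, p a₁ a₂ y′)`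
  let Φ : W →ₗ[ℂ] W →ₗ[ℂ] ℂ := γ ∘ₗ p a₁ a₂ + (γ.flip ∘ₗ p a₁ a₂).flip
  have hΦ : ∀ y y', Φ y y' = γ (p a₁ a₂ y) y' + γ y (p a₁ a₂ y') := fun y y' => by
    simp only [Φ, LinearMap.add_apply, LinearMap.coe_comp, Function.comp_apply, LinearMap.flip_apply]
  rw [← hΦ]
  refine form_eq_zero_of_gen hspan (fun a i b j => ?_) y y'
  rw [hΦ]
  -- case analysis on the block indices
  by_cases ha2 : a₂ = a
  · subst ha2
    rw [block_apply_gen hpp hm]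
    by_cases hb2 : a₂ = b
    · subst hb2
      rw [block_apply_gen hpp hm]
      by_cases hij : i = j
      · subst hij
        rw [F2 a₁ a₂ i ha, hγ (m a₂ i) (m a₁ i), F2 a₁ a₂ i ha, add_zero]
      · rw [hγ (m a₂ i) (m a₁ j)]
        exact F4 a₁ a₂ i j ha hij
    · rw [block_apply_gen_of_ne hpp0 hm a₁ hb2, map_zero, add_zero]
      have hb : b = a₁ := by omega
      subst hb
      exact hsame b i j
  · rw [block_apply_gen_of_ne hpp0 hm a₁ ha2, map_zero, LinearMap.zero_apply, zero_add]
    by_cases hb2 : a₂ = b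
    · subst hb2
      rw [block_apply_gen hpp hm]
      have hb : a = a₁ := by omega
      subst hb
      exact hsame a i j
    · rw [block_apply_gen_of_ne hpp0 hm a₁ hb2, map_zero]

/-- **SEGRE VANISHING, diagonal block units:** under the vanishing of all decomposable compressions,
`γ(p 0 0 y, y′) + γ(y, p 0 0 y′) = γ(p 1 1 y, y′) + γ(y, p 1 1 y′)` (the traceless diagonal element `p 0 0 − p 1 1` of
`𝔰𝔩₂ ⊗ 1` annihilates `γ`). [cite: FultonHarrisGTM129, §6.1 Exercise 6.11] [cite: MoonenZarhin1999LowDim, §2 (2.5)] -/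
theorem form_diag_eq (hpp : ∀ a b d, p a b * p b d = p a d) (hpp0 : ∀ a b c d, b ≠ c → p a b * p c d = 0)
    (hp1 : p 0 0 + p 1 1 = 1)
    (hgf : ∀ j, g j * f j = E) (hEg : ∀ j, E * g j = g j) (hsum : f 0 * g 0 + f 1 * g 1 + f 2 * g 2 = 1)
    (hpf : ∀ a b i, p a b * f i = f i * p a b) (hpg : ∀ a b j, p a b * g j = g j * p a b)
    (hline : ∀ y, ∃ t : ℂ, (p a₀ a₀ * (f i₀ * g i₀)) y = t • m₀)
    (hm : ∀ a i, m a i = (p a a₀ * (f i * g i₀)) m₀) (hγ : ∀ y y', γ y y' = γ y' y)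
    (hvan : ∀ (a b : Fin 2) (i j : Fin 3) (c c' : ℂ), a ≠ b → i ≠ j →
      ∀ y y', γ (((f i * g i + c' • (f j * g i)) * (p a a + c • p b a)) y)
        (((f i * g i + c' • (f j * g i)) * (p a a + c • p b a)) y') = 0)
    (y y' : W) : γ (p 0 0 y) y' + γ y (p 0 0 y') = γ (p 1 1 y) y' + γ y (p 1 1 y') := by
  obtain ⟨F1, -, F3, -⟩ := coord_identities hpp hgf hEg hpf hpg hm hγ hvan
  have hspan := exists_sum_eq hpp hp1 hgf hEg hsum hpf hpg hline hm
  have hsame : ∀ a i j, γ (m a i) (m a j) = 0 := fun a i j => by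
    by_cases hij : i = j
    · subst hij; exact F1 a i
    · exact F3 a i j hij
  let Φ : W →ₗ[ℂ] W →ₗ[ℂ] ℂ :=
    γ ∘ₗ (p 0 0 - p 1 1) + (γ.flip ∘ₗ (p 0 0 - p 1 1)).flip
  have hΦ : ∀ y y', Φ y y' = γ (p 0 0 y) y' + γ y (p 0 0 y') - (γ (p 1 1 y) y' + γ y (p 1 1 y')) := fun y y' => by
    simp only [Φ, LinearMap.add_apply, LinearMap.coe_comp, Function.comp_apply, LinearMap.flip_apply,
      LinearMap.sub_apply, map_sub]
    ring
  rw [← sub_eq_zero, ← hΦ]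
  refine form_eq_zero_of_gen hspan (fun a i b j => ?_) y y'
  rw [hΦ]
  have h00 : ∀ i, p 0 0 (m 0 i) = m 0 i := fun i => block_apply_gen hpp hm 0 0 i
  have h11 : ∀ i, p 1 1 (m 1 i) = m 1 i := fun i => block_apply_gen hpp hm 1 1 i
  have h01 : ∀ i, p 0 0 (m 1 i) = 0 := fun i => block_apply_gen_of_ne hpp0 hm 0 (by decide) i
  have h10 : ∀ i, p 1 1 (m 0 i) = 0 := fun i => block_apply_gen_of_ne hpp0 hm 1 (by decide) i
  fin_cases a <;> fin_cases b <;>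
    simp only [Fin.isValue, Fin.zero_eta, Fin.mk_one, h00, h11, h01, h10, hsame, map_zero, LinearMap.zero_apply,
      add_zero, zero_add, sub_self]

end Segre

end SkeletonSegre

end HodgeStructure

end Literature.AlgebraicGeometry.Motives
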